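import Summits.CriticalPhenomena.PercolationContinuityZ3.Theorems.Transplant.Bcc111HubLegs
import Summits.CriticalPhenomena.PercolationContinuityZ3.Theorems.Transplant.BccSlabHubRoute
import HarnessLib

/-!
# The bcc (111)-films `F_m(bcc)`, exit-form routing certificate VIII: A SWAP PAIR OF ROUTINGS FROM A CLAW (`m ≥ 6`)

builds on p205010 (kernel theorem, internal audit signed; external expert review pending) — NOT used in this file.
Lane `prim-bschramm`, seat `prim-bschramm-p2` (gen 48; class C1b, METHOD = input substitution; memo `HOME/bschramm/P2-LATTICES.md` §159); helper file
(`--supports stmt-CriticalPhenomena-4575 --as helper`).  **`Bcc111.swapPair_of_claw`**: for a claw of the planar model («Bcc111ClawSound».`ClawProps`) whose targets are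
the columns of the terminals `Ea, Eb` (rerouting set) and `w'` (cleared set) — with, when `Ea, Eb` share a column, `Ea` below `Eb` and the stacked type of their levels —
the `K_{2,3}` elevator hub («Bcc111HubKit»), the three 3D legs («Bcc111HubLegs»: from the chain ports over the chain-port columns, and from `n` through the first vertex over
the exit column) and «BccSlabHubRoute».`VRouteData.swapPair_of_hub` give a SWAP PAIR of `VRouteData` for `(E₁, E₂, w')` in either order of `{Ea, Eb}`.
Column-disjointness of the planar legs gives vertex-disjointness; the stacked legs meet the common column only at their own terminals.
[cite: DuminilCopinSidoraviciusTassion2016, §2.3 (proof of Fact 2: the three disjoint paths γ_u, γ_v, γ_w in B̄_R(z))] [cite: ConwaySloane1999, Ch. 4 §7.1]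
-/

noncomputable section

namespace Summit.CriticalPhenomena.PercolationContinuityZ3.Theorems.Transplant

namespace Bcc111

open MeasureTheory Literature.Probability.Percolation Literature.Probability.LatticeModels SimpleGraph
open Slab111 (lev)
open BccClawX (Pt rel)
open Bcc111Claw (tnZ inRB inDB rem0 remM penLo penHi penult LegProps ClawProps uvec others hubCols)
open scoped Classical

variable {m : ℕ}

/-- The chain-port columns differ from the exit columns of a hub slot. [folklore] -/
theorem F_ne_X (z : Site 2) {Q : Pt} {i : ℕ} {up : Bool} {bc F0 F1 X0 X1 : Pt} (hh : hubCols Q i up = (bc, F0, F1, X0, X1)) (hi : i ≤ 2) :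
    F0 ≠ X0 ∧ F0 ≠ X1 ∧ F1 ≠ X0 ∧ F1 ≠ X1 := by
  obtain ⟨-, eF0, eF1, eX0, eX1⟩ := hubCols_pt z hh
  obtain ⟨hj, hk, hsum⟩ := others_spec hi
  have huj := isUp_uvec hj; have huk := isUp_uvec hk; have hui := isUp_uvec hi
  have hσ : (if up then (1 : ℤ) else -1) = 1 ∨ (if up then (1 : ℤ) else -1) = -1 := by cases up <;> simp
  -- `σ•u = −σ•v` forces `u = −v`
  have key : ∀ {u v : Site 2}, IsUp u → IsUp v → BccClawX.pt z Q + (if up then (1 : ℤ) else -1) • u = BccClawX.pt z Q - (if up then (1 : ℤ) else -1) • v → False := by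
    intro u v hu hv h
    have h' : u = -v := by
      rcases hσ with e | e <;> rw [e] at h
      · simpa [sub_eq_add_neg] using h
      · have := add_left_cancel (h.trans (by simp [sub_eq_add_neg] : BccClawX.pt z Q - (-1 : ℤ) • v = BccClawX.pt z Q + v))
        rw [neg_one_smul, neg_eq_iff_eq_neg] at this; exact this
    subst h'; exact not_isUp_neg hv hu
  have ne : ∀ {F X : Pt} {u v : Site 2}, IsUp u → IsUp v → BccClawX.pt z F = BccClawX.pt z Q + (if up then (1 : ℤ) else -1) • u →
      BccClawX.pt z X = BccClawX.pt z Q - (if up then (1 : ℤ) else -1) • v → F ≠ X := by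
    intro F X u v hu hv hF hX hFX; subst hFX; exact key hu hv (hF.symm.trans hX)
  exact ⟨ne huj huj eF0 eX0, ne huj huk eF0 eX1, ne huk huj eF1 eX0, ne huk huk eF1 eX1⟩

/-- **A SWAP PAIR OF ROUTINGS FROM A CLAW** (`m ≥ 6`). [cite: DuminilCopinSidoraviciusTassion2016, §2.3 (proof of Fact 2)] -/
theorem swapPair_of_claw (hm : 6 ≤ m) (z : Site 2) {tR tD sR sD : ℕ} (htRD : tR ≤ tD) (hsRD : sR ≤ sD)
    {a1 a2 a3 : Pt} {ty : ℕ} {Q : Pt} {i : ℕ} {up : Bool} {bc F0 F1 X0 X1 s1 s2 s3 : Pt} {l1 l2 l3 : List Pt}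
    (hP : ClawProps (min tR 3) (min tD 3) (min sR 3) (min sD 3) a1 a2 a3 ty Q i up bc F0 F1 X0 X1 s1 s2 s3 l1 l2 l3)
    {Ea Eb w' : bfilm m} (hEa : rel z (sh Ea) = a1) (hEb : rel z (sh Eb) = a2) (hw : rel z (sh w') = a3) (hne : Ea ≠ Eb)
    (hEaW : Ea ∈ clearedSet m z tR tD sR sD ∩ (hexShadow m).lift (blkR 3 z tR sR))
    (hEbW : Eb ∈ clearedSet m z tR tD sR sD ∩ (hexShadow m).lift (blkR 3 z tR sR)) (hwW : w' ∈ clearedSet m z tR tD sR sD)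
    (hstk : a1 = a2 → lev (pt Ea) < lev (pt Eb) ∧ ((ty / 3 : ℕ) : ℤ) = min (lev (pt Ea)) 2 ∧ ((ty % 3 : ℕ) : ℤ) = min ((m : ℤ) - lev (pt Eb)) 2)
    {E₁ E₂ : bfilm m} (hE : (E₁ = Ea ∧ E₂ = Eb) ∨ (E₁ = Eb ∧ E₂ = Ea)) :
    ∃ r₁ r₂ : VRouteData (film m) (clearedSet m z tR tD sR sD ∩ (hexShadow m).lift (blkR 3 z tR sR)) (clearedSet m z tR tD sR sD) E₁ E₂ w',
      r₁.y = r₂.b ∧ r₁.b = r₂.y := by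
  set WR := clearedSet m z tR tD sR sD ∩ (hexShadow m).lift (blkR 3 z tR sR) with hWRdef
  set W := clearedSet m z tR tD sR sD with hWdef
  have hWRW : WR ⊆ W := fun x hx => hx.1
  have hm5 : 5 ≤ m := le_trans (by norm_num) hm
  obtain ⟨y, b, n, p0, p1, x0, x1, H⟩ := exists_hubFacts hm z htRD hsRD hP.hh hP.hi hP.hQ hP.hQ0 hP.hQm hP.hbc
  obtain ⟨hF0X0, hF0X1, hF1X0, hF1X1⟩ := F_ne_X z hP.hh hP.hi
  obtain ⟨A, B, X, hAB, hX, harr⟩ := hP.hst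
  -- flags: which start columns are exit columns
  have hnotX : ∀ {s : Pt}, s = A ∨ s = B → ¬ (s = X0 ∨ s = X1) := by
    rintro s hs (rfl | rfl) <;> rcases hAB with ⟨rfl, rfl⟩ | ⟨rfl, rfl⟩ <;> rcases hs with h | h <;>
      first | exact hF0X0 h.symm | exact hF0X1 h.symm | exact hF1X0 h.symm | exact hF1X1 h.symm
  have hall : ∀ {s : Pt}, s = A ∨ s = B ∨ s = X → s = F0 ∨ s = F1 ∨ s = X0 ∨ s = X1 := by
    rintro s (rfl | rfl | rfl)
    · rcases hAB with ⟨rfl, -⟩ | ⟨rfl, -⟩ <;> simp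
    · rcases hAB with ⟨-, rfl⟩ | ⟨-, rfl⟩ <;> simp
    · rcases hX with rfl | rfl <;> simp
  have hs123 : (s1 = F0 ∨ s1 = F1 ∨ s1 = X0 ∨ s1 = X1) ∧ (s2 = F0 ∨ s2 = F1 ∨ s2 = X0 ∨ s2 = X1) ∧ (s3 = F0 ∨ s3 = F1 ∨ s3 = X0 ∨ s3 = X1) ∧
      ¬ ((s1 = X0 ∨ s1 = X1) ∧ (s2 = X0 ∨ s2 = X1)) ∧ ¬ ((s1 = X0 ∨ s1 = X1) ∧ (s3 = X0 ∨ s3 = X1)) ∧ ¬ ((s2 = X0 ∨ s2 = X1) ∧ (s3 = X0 ∨ s3 = X1)) := by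
    rcases harr with h | h | h <;> simp only [Prod.mk.injEq] at h <;> obtain ⟨rfl, rfl, rfl⟩ := h
    · exact ⟨hall (Or.inr (Or.inr rfl)), hall (Or.inl rfl), hall (Or.inr (Or.inl rfl)), fun h => hnotX (Or.inl rfl) h.2, fun h => hnotX (Or.inr rfl) h.2,
        fun h => hnotX (Or.inl rfl) h.1⟩
    · exact ⟨hall (Or.inl rfl), hall (Or.inr (Or.inr rfl)), hall (Or.inr (Or.inl rfl)), fun h => hnotX (Or.inl rfl) h.1, fun h => hnotX (Or.inl rfl) h.1,
        fun h => hnotX (Or.inr rfl) h.2⟩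
    · exact ⟨hall (Or.inl rfl), hall (Or.inr (Or.inl rfl)), hall (Or.inr (Or.inr rfl)), fun h => hnotX (Or.inl rfl) h.1, fun h => hnotX (Or.inl rfl) h.1,
        fun h => hnotX (Or.inr rfl) h.1⟩
  obtain ⟨hs1, hs2, hs3, hx12, hx13, hx23⟩ := hs123
  -- start kits: port `c`, first lifted vertex `v`, and the prefix `pre` from `c` to `v`
  have kit : ∀ s : Pt, (s = F0 ∨ s = F1 ∨ s = X0 ∨ s = X1) →
      ∃ (c v : bfilm m) (pre : List (bfilm m)), GPath (film m) pre c v ∧ (film m).Adj y c ∧ (film m).Adj b c ∧ rel z (sh v) = s ∧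
        1 ≤ lev (pt v) ∧ lev (pt v) ≤ (m : ℤ) - 1 ∧ (∀ x ∈ pre, x = v ∨ ((s = X0 ∨ s = X1) ∧ x = n)) ∧ (∀ x ∈ pre, x ∈ WR ∨ x = v) := by
    rintro s (rfl | rfl | rfl | rfl)
    · exact ⟨p0, p0, [p0], GPath.single _ _, H.yp0, H.bp0, H.shp0, H.levp0.1, H.levp0.2, by simp, by simp⟩
    · exact ⟨p1, p1, [p1], GPath.single _ _, H.yp1, H.bp1, H.shp1, H.levp1.1, H.levp1.2, by simp, by simp⟩
    · exact ⟨n, x0, [n, x0], GPath.pair H.nx0, H.yn, H.bn, H.shx0, H.levx0.1, H.levx0.2,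
        fun x hx => by simp only [List.mem_cons, List.not_mem_nil, or_false] at hx; rcases hx with rfl | rfl <;> simp,
        fun x hx => by simp only [List.mem_cons, List.not_mem_nil, or_false] at hx; rcases hx with rfl | rfl; exacts [Or.inl H.nWR, Or.inr rfl]⟩
    · exact ⟨n, x1, [n, x1], GPath.pair H.nx1, H.yn, H.bn, H.shx1, H.levx1.1, H.levx1.2,
        fun x hx => by simp only [List.mem_cons, List.not_mem_nil, or_false] at hx; rcases hx with rfl | rfl <;> simp,
        fun x hx => by simp only [List.mem_cons, List.not_mem_nil, or_false] at hx; rcases hx with rfl | rfl; exacts [Or.inl H.nWR, Or.inr rfl]⟩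
  -- avoid lists
  have hav1 : Q ∉ l1 ∧ bc ∉ l1 ∧ a3 ∉ l1 := by
    refine ⟨fun h => ?_, fun h => ?_, fun h => ?_⟩ <;> have := hP.leg1.not_avoid _ h <;> split_ifs at this <;> simp at this
  have hav2 : Q ∉ l2 ∧ bc ∉ l2 ∧ a3 ∉ l2 := by
    refine ⟨fun h => ?_, fun h => ?_, fun h => ?_⟩ <;> have := hP.leg2.not_avoid _ h <;> split_ifs at this <;> simp at this
  have hav3 : Q ∉ l3 ∧ bc ∉ l3 ∧ a1 ∉ l3 ∧ a2 ∉ l3 := by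
    refine ⟨fun h => ?_, fun h => ?_, fun h => ?_, fun h => ?_⟩ <;> have := hP.leg3.not_avoid _ h <;> simp at this
  -- region facts
  have hS12 : ∀ {l : List Pt}, (∀ w ∈ l, inRB (min tR 3) (min sR 3) w = true) →
      ∀ x : bfilm m, rel z (sh x) ∈ l → 1 ≤ lev (pt x) → lev (pt x) ≤ (m : ℤ) - 1 → x ∈ WR :=
    fun hR x hx h1 h2 => mem_WR_of_lev htRD hsRD (hR _ hx) h1 h2
  have hS3 : ∀ x : bfilm m, rel z (sh x) ∈ l3 → 1 ≤ lev (pt x) → lev (pt x) ≤ (m : ℤ) - 1 → x ∈ W :=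
    fun x hx h1 h2 => mem_W_of_lev (hP.leg3.mem_R _ hx) h1 h2
  -- the three 3D legs, each: full list `F`, port `c`, flag `s ∈ {X0, X1}`
  have legE : ∀ (lower : Bool) (E E' : bfilm m) (s a : Pt) (l : List Pt) (avoid : List Pt), (s = F0 ∨ s = F1 ∨ s = X0 ∨ s = X1) →
      LegProps (inRB (min tR 3) (min sR 3)) avoid s a l → rel z (sh E) = a → E ∈ WR → Q ∉ l →
      (a1 = a2 → sh E = sh E' ∧ (lower = true → lev (pt E) < lev (pt E') ∧ penLo (min tR 3) (min sR 3) a (ty / 3) (penult l) = true ∧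
          ((ty / 3 : ℕ) : ℤ) = min (lev (pt E)) 2) ∧
        (lower = false → lev (pt E') < lev (pt E) ∧ penHi (min tR 3) (min sR 3) a (ty % 3) (penult l) = true ∧
          ((ty % 3 : ℕ) : ℤ) = min ((m : ℤ) - lev (pt E)) 2)) →
      ∃ (c : bfilm m) (Fl : List (bfilm m)), GPath (film m) Fl c E ∧ (film m).Adj y c ∧ (film m).Adj b c ∧ (∀ x ∈ Fl, x ∈ WR) ∧
        (∀ x ∈ Fl, ((s = X0 ∨ s = X1) ∧ x = n) ∨ (rel z (sh x) ∈ l ∧ (a1 = a2 → rel z (sh x) ∈ l.dropLast ∨ x = E))) := by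
    intro lower E E' s a l avoid hs hl hE hEW hQl hst
    obtain ⟨c, v, pre, hpre, hyc, hbc', hv, hv1, hvm, hpre1, hpre2⟩ := kit s hs
    -- the lifted part
    obtain ⟨L, hL, hLW, hLcol⟩ : ∃ L : List (bfilm m), GPath (film m) L v E ∧ (∀ x ∈ L, x ∈ WR) ∧
        (∀ x ∈ L, rel z (sh x) ∈ l ∧ (a1 = a2 → rel z (sh x) ∈ l.dropLast ∨ x = E)) := by
      by_cases heq : a1 = a2
      · obtain ⟨hsh, hlo, hhi⟩ := hst heq
        cases lower with
        | true =>
          obtain ⟨hlt, hpen, hτ⟩ := hlo rfl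
          obtain ⟨L, hL, hLW, hLc⟩ := leg_exact_lo hm z htRD hsRD hl hpen v E E' hv hv1 hvm hE hsh hlt hτ hEW
          refine ⟨L, hL, hLW, fun x hx => ⟨?_, fun _ => hLc x hx⟩⟩
          rcases hLc x hx with h | rfl
          · exact List.dropLast_subset l h
          · rw [hE, ← hl.last]; exact List.getLast_mem _
        | false =>
          obtain ⟨hlt, hpen, hτ⟩ := hhi rfl
          obtain ⟨L, hL, hLW, hLc⟩ := leg_exact_hi hm z htRD hsRD hl hpen v E' E hv hv1 hvm hE hsh.symm hlt hτ hEW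
          refine ⟨L, hL, hLW, fun x hx => ⟨?_, fun _ => hLc x hx⟩⟩
          rcases hLc x hx with h | rfl
          · exact List.dropLast_subset l h
          · rw [hE, ← hl.last]; exact List.getLast_mem _
      · obtain ⟨L, hL, hLW, hLc⟩ := leg_plain hm5 z hl (hS12 hl.mem_R) v E hv hv1 hvm hE hEW
        exact ⟨L, hL, hLW, fun x hx => ⟨hLc x hx, fun h => absurd h heq⟩⟩
    have hnL : n ∉ L := fun h => hQl (by have := (hLcol n h).1; rwa [H.shn] at this)
    refine ⟨c, pre ++ L.tail, hpre.trans hL (fun x hx hxp => ?_), hyc, hbc', fun x hx => ?_, fun x hx => ?_⟩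
    · rcases hpre1 x hxp with h | ⟨-, h⟩
      · exact h
      · exact absurd hx (h ▸ hnL)
    · rcases List.mem_append.1 hx with hx | hx
      · rcases hpre2 x hx with h | rfl
        · exact h
        · exact hLW _ hL.head_mem
      · exact hLW _ (List.mem_of_mem_tail hx)
    · rcases List.mem_append.1 hx with hx | hx
      · rcases hpre1 x hx with rfl | h
        · exact Or.inr (hLcol _ hL.head_mem)
        · exact Or.inl h
      · exact Or.inr (hLcol _ (List.mem_of_mem_tail hx))
  -- the terminal legs
  have hshab : a1 = a2 → sh Ea = sh Eb := fun h => rel_injective z (by rw [hEa, hEb, h])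
  obtain ⟨cA, FA, hFA, hycA, hbcA, hFAW, hFAc⟩ := legE true Ea Eb s1 a1 l1 _ hs1 hP.leg1 hEa hEaW hav1.1
    (fun h => ⟨hshab h, fun _ => ⟨(hstk h).1, hP.pen1 h, (hstk h).2.1⟩, fun hf => absurd hf (by simp)⟩)
  obtain ⟨cB, FB, hFB, hycB, hbcB, hFBW, hFBc⟩ := legE false Eb Ea s2 a2 l2 _ hs2 hP.leg2 hEb hEbW hav2.1
    (fun h => ⟨(hshab h).symm, fun hf => absurd hf (by simp), fun _ => ⟨(hstk h).1, by rw [← h]; exact hP.pen2 h, (hstk h).2.2⟩⟩)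
  -- the leg to `w'`
  obtain ⟨cC, FC, hFC, hycC, hbcC, hFCW, hFCc⟩ : ∃ (c : bfilm m) (Fl : List (bfilm m)), GPath (film m) Fl c w' ∧ (film m).Adj y c ∧ (film m).Adj b c ∧
      (∀ x ∈ Fl, x ∈ W) ∧ (∀ x ∈ Fl, ((s3 = X0 ∨ s3 = X1) ∧ x = n) ∨ rel z (sh x) ∈ l3) := by
    obtain ⟨c, v, pre, hpre, hyc, hbc', hv, hv1, hvm, hpre1, hpre2⟩ := kit s3 hs3
    obtain ⟨L, hL, hLW, hLcol⟩ := leg_plain hm5 z hP.leg3 hS3 v w' hv hv1 hvm hw hwW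
    have hnL : n ∉ L := fun h => hav3.1 (by have := hLcol n h; rwa [H.shn] at this)
    refine ⟨c, pre ++ L.tail, hpre.trans hL (fun x hx hxp => ?_), hyc, hbc', fun x hx => ?_, fun x hx => ?_⟩
    · rcases hpre1 x hxp with h | ⟨-, h⟩
      · exact h
      · exact absurd hx (h ▸ hnL)
    · rcases List.mem_append.1 hx with hx | hx
      · rcases hpre2 x hx with h | rfl
        · exact hWRW h
        · exact hLW _ hL.head_mem
      · exact hLW _ (List.mem_of_mem_tail hx)
    · rcases List.mem_append.1 hx with hx | hx
      · rcases hpre1 x hx with rfl | h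
        · exact Or.inr (hLcol _ hL.head_mem)
        · exact Or.inl h
      · exact Or.inr (hLcol _ (List.mem_of_mem_tail hx))
  -- disjointness
  have ha1l1 : a1 = a2 → a1 ∉ l1.dropLast := fun _ => (hP.leg1.split).2.2.1
  have ha2l2 : a1 = a2 → a2 ∉ l2.dropLast := fun _ => (hP.leg2.split).2.2.1
  have hAB : ∀ x ∈ FA, x ∉ FB := by
    intro x hxA hxB
    rcases hFAc x hxA with ⟨f1, rfl⟩ | ⟨c1, f1⟩ <;> rcases hFBc x hxB with ⟨f2, e2⟩ | ⟨c2, f2⟩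
    · exact hx12 ⟨f1, f2⟩
    · rw [H.shn] at c2; exact hav2.1 c2
    · rw [e2, H.shn] at c1; exact hav1.1 c1
    · by_cases heq : a1 = a2
      · rcases f1 heq with d1 | rfl <;> rcases f2 heq with d2 | e
        · obtain ⟨-, hw⟩ := hP.d12 _ (List.dropLast_subset _ d1) (List.dropLast_subset _ d2)
          exact ha1l1 heq (hw ▸ d1)
        · rw [e, hEb] at d1; exact ha1l1 heq (heq ▸ d1)
        · rw [hEa] at d2; exact ha2l2 heq (heq ▸ d2)
        · exact hne e
      · exact heq (hP.d12 _ c1 c2).1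
  have hAC : ∀ x ∈ FA, x ∉ FC := by
    intro x hxA hxC
    rcases hFAc x hxA with ⟨f1, rfl⟩ | ⟨c1, -⟩ <;> rcases hFCc x hxC with ⟨f3, e3⟩ | c3
    · exact hx13 ⟨f1, f3⟩
    · rw [H.shn] at c3; exact hav3.1 c3
    · rw [e3, H.shn] at c1; exact hav1.1 c1
    · exact hP.d31 _ c3 c1
  have hBC : ∀ x ∈ FB, x ∉ FC := by
    intro x hxB hxC
    rcases hFBc x hxB with ⟨f2, rfl⟩ | ⟨c2, -⟩ <;> rcases hFCc x hxC with ⟨f3, e3⟩ | c3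
    · exact hx23 ⟨f2, f3⟩
    · rw [H.shn] at c3; exact hav3.1 c3
    · rw [e3, H.shn] at c2; exact hav2.1 c2
    · exact hP.d32 _ c3 c2
  have hyA : y ∉ FA := fun h => by
    rcases hFAc y h with ⟨-, e⟩ | ⟨c1, -⟩
    · exact H.y_ne_n e
    · rw [H.shy] at c1; exact hav1.1 c1
  have hyB : y ∉ FB := fun h => by
    rcases hFBc y h with ⟨-, e⟩ | ⟨c2, -⟩
    · exact H.y_ne_n e
    · rw [H.shy] at c2; exact hav2.1 c2
  have hyC : y ∉ FC := fun h => by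
    rcases hFCc y h with ⟨-, e⟩ | c3
    · exact H.y_ne_n e
    · rw [H.shy] at c3; exact hav3.1 c3
  have hbA : b ∉ FA := fun h => by
    rcases hFAc b h with ⟨-, e⟩ | ⟨c1, -⟩
    · exact H.b_ne_n e
    · rw [H.shb] at c1; exact hav1.2.1 c1
  have hbB : b ∉ FB := fun h => by
    rcases hFBc b h with ⟨-, e⟩ | ⟨c2, -⟩
    · exact H.b_ne_n e
    · rw [H.shb] at c2; exact hav2.2.1 c2
  have hbC : b ∉ FC := fun h => by
    rcases hFCc b h with ⟨-, e⟩ | c3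
    · exact H.b_ne_n e
    · rw [H.shb] at c3; exact hav3.2.1 c3
  rcases hE with ⟨rfl, rfl⟩ | ⟨rfl, rfl⟩
  · exact VRouteData.swapPair_of_hub hFA hFB hFC hne hFAW hFBW hFCW H.yWR H.bWR hWRW hycA.symm hbcA.symm hycB hbcB hycC hbcC H.y_ne_b
      hAB hAC hBC hyA hyB hyC hbA hbB hbC
  · exact VRouteData.swapPair_of_hub hFB hFA hFC hne.symm hFBW hFAW hFCW H.yWR H.bWR hWRW hycB.symm hbcB.symm hycA hbcA hycC hbcC H.y_ne_b
      (fun x hx hx' => hAB x hx' hx) hBC hAC hyB hyA hyC hbB hbA hbC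

end Bcc111

end Summit.CriticalPhenomena.PercolationContinuityZ3.Theorems.Transplant

end
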